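import Literature.MathematicalPhysics.QuantumLattice.HubbardWindowCertificate
import HarnessLib

/-!
# Hubbard tori generated by an additive lattice map (Part I: graph, Hamiltonian, window embedding)

HONEST FRAMING: first certified bounds; not a superconductivity verdict; every number certified or
labelled float. This file is INFRASTRUCTURE for the kernel transport of NN-Hubbard window certificates
(Han 2020 / Kull–Schuch–Dive–Navascués 2024 shape, exactly the data of
`Literature.MathematicalPhysics.QuantumLattice.groundEnergyAt_div_ge_of_window_certificate`) to the
tori generated by an arbitrary ADDITIVE LATTICE MAP `φ : ℤ^d →+ (ℤ/Nℤ)^{d'}`: the torus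
`(ℤ/Nℤ)^{d'}` with the `2d` hops `±φ(eᵢ)`. The square torus of side `L` is `φ = (x ↦ x mod L)`;
the point of the generalisation is the Chinese-remainder presentation of RECTANGULAR periodic tori
`ℤ/aℤ × ℤ/bℤ ≅ ℤ/abℤ` (`gcd(a,b) = 1`), e.g. the `3 × 4` torus as the ring `ℤ/12ℤ` with hops
`{±4, ±9} = {±4, ∓3}` (`φ(x) = 4x₀ + 9x₁ mod 12`) and the `3 × 5` torus as `ℤ/15ℤ` with hops `{±10, ±6}`,
on which the tree's `d'`-dimensional translation-averaging engine
`torus_minEnergyOn_div_ge_of_local_certificate` (carrier `FermionTorus d' N`) applies verbatim.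

Contents: the site graph `homSiteGraph φ` on `(ℤ/Nℤ)^{d'}` (`x ∼ y ↔ x ≠ y ∧ ∃ i, y = x ± φ(eᵢ)`), its
pull-back `homTorusGraph φ` to `FermionTorus d' N`, the Hamiltonian `homHubbard φ t U :=
hamiltonian (homTorusGraph φ) t U` with its symmetries (Hermitian, `N̂`, `S^z`, all translations of
`(ℤ/Nℤ)^{d'}`), the non-degeneracy condition `Function.Injective (signedHop φ)` (the `2d` signed hops `±φ(eᵢ)`
are pairwise distinct — for `x ↦ x mod L` this is `L ≥ 3`) with the neighbour-sum identity
`Σ_{y ∼ x} g y = Σᵢ (g (x + φ eᵢ) + g (x − φ eᵢ))`, the window embedding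
`homEmb φ : PolySite Λ ↪ FermionTorus d' N` (`x ↦ φ x`, for `φ` injective on `Λ`) and the transport of
lattice bonds (a lattice bond of the window is a torus bond; a torus bond at the image of the inner
region comes from a lattice bond — SHARP hypothesis: `φ` injective on `Λ'` only).
Parts II–III (`HomTorusLocalHamiltonian`, `HomTorusEnergyDensity`) and the theorem
(`TorusCeilingHom`) follow. Patterned on the tree's `HubbardTorusLocalHamiltonianDecomposition`,
`InfVolFermionState(HubbardEnergy)`, `FockRelabel` and pub-mbboot's `HubbardTorusCommutatorSharp`.
[cite: Han2020Bootstrap, §3] [cite: FriedliVelenik2017, §3.1] [cite: BratteliRobinsonII1997, §5.2.2]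
-/

noncomputable section

open Matrix Finset
open Literature.MathematicalPhysics.QuantumLattice
open Literature.MathematicalPhysics.QuantumFieldTheory hiding Site
open Literature.MathematicalPhysics.QuantumManyBody.StateRelaxation
open Literature.Probability.LatticeModels
open HubbardWave0
open scoped ComplexOrder ComplexConjugate

namespace Summit.Ventures.CertifiedManyBodySolver.Rows

section Model

variable {d d' N : ℕ} (φ : Site d →+ TorusSite d' N)

/-! ### §1. The site graph, its pull-back to the fermionic torus, the Hamiltonian -/

/-- **The torus graph generated by an additive lattice map** `φ : ℤ^d →+ (ℤ/Nℤ)^{d'}`: the sites of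
`(ℤ/Nℤ)^{d'}`, `x ∼ y` iff `x ≠ y` and `y = x ± φ(eᵢ)` for some lattice direction `i`. For
`φ = (x ↦ x mod L)` this is the nearest-neighbour torus `torusGraph d L`; for `d' = 1`,
`φ(x) = Σᵢ cᵢ xᵢ mod N` it is the circulant ring with connection set `{±cᵢ}` (CRT presentation of a
rectangular torus). [cite: FriedliVelenik2017, §3.1] -/
def homSiteGraph : SimpleGraph (TorusSite d' N) where
  Adj x y := x ≠ y ∧ ∃ i : Fin d, y = x + φ (unitVec i) ∨ x = y + φ (unitVec i)
  symm := ⟨fun _ _ h => ⟨h.1.symm, h.2.imp fun _ hi => hi.symm⟩⟩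
  loopless := ⟨fun _ h => h.1 rfl⟩

/-- Adjacency of `homSiteGraph φ`, unfolded. [folklore] -/
theorem homSiteGraph_adj_iff (x y : TorusSite d' N) :
    (homSiteGraph φ).Adj x y ↔ x ≠ y ∧ ∃ i : Fin d, y = x + φ (unitVec i) ∨ x = y + φ (unitVec i) :=
  Iff.rfl

/-- Adjacency of `homSiteGraph φ` is decidable. [folklore] -/
instance instDecidableRelHomSiteGraphAdj : DecidableRel (homSiteGraph φ).Adj := fun x y =>
  inferInstanceAs (Decidable (x ≠ y ∧ ∃ i : Fin d, y = x + φ (unitVec i) ∨ x = y + φ (unitVec i)))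

/-- Adjacency of `homSiteGraph φ` is translation invariant. [cite: FriedliVelenik2017, §3.1] -/
theorem homSiteGraph_adj_add_right (v x y : TorusSite d' N) :
    (homSiteGraph φ).Adj (x + v) (y + v) ↔ (homSiteGraph φ).Adj x y := by
  have h1 : ∀ u : TorusSite d' N, y + v = x + v + u ↔ y = x + u := fun u => by
    rw [add_right_comm x v u, add_left_inj]
  have h2 : ∀ u : TorusSite d' N, x + v = y + v + u ↔ x = y + u := fun u => by
    rw [add_right_comm y v u, add_left_inj]
  simp only [homSiteGraph_adj_iff, ne_eq, add_left_inj, h1, h2]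

/-- **The pull-back of `homSiteGraph φ` to the fermionic torus** `FermionTorus d' N` (sites compared
through `FermionTorus.toTorusSite`, as the tree's `fermionTorusGraph`). [cite: FriedliVelenik2017, §3.1] -/
def homTorusGraph : SimpleGraph (FermionTorus d' N) :=
  (homSiteGraph φ).comap FermionTorus.toTorusSite

/-- Adjacency on the fermionic torus is adjacency of the torus sites. [folklore] -/
theorem homTorusGraph_adj (a b : FermionTorus d' N) :
    (homTorusGraph φ).Adj a b ↔ (homSiteGraph φ).Adj a.toTorusSite b.toTorusSite := Iff.rfl

/-- Adjacency of `homTorusGraph φ` is decidable. [folklore] -/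
instance instDecidableRelHomTorusGraphAdj : DecidableRel (homTorusGraph φ).Adj := fun a b =>
  inferInstanceAs (Decidable ((homSiteGraph φ).Adj a.toTorusSite b.toTorusSite))

variable [NeZero N]

/-- Adjacency of the sites `ofTorusSite x`, `ofTorusSite y`. [folklore] -/
theorem homTorusGraph_adj_ofTorusSite (x y : TorusSite d' N) :
    (homTorusGraph φ).Adj (FermionTorus.ofTorusSite x) (FermionTorus.ofTorusSite y) ↔
      (homSiteGraph φ).Adj x y := by
  rw [homTorusGraph_adj, FermionTorus.toTorusSite_ofTorusSite, FermionTorus.toTorusSite_ofTorusSite]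

/-- The translations `x ↦ x + v` are automorphisms of `homTorusGraph φ`. [cite: FriedliVelenik2017, §3.1] -/
theorem homTorusGraph_adj_addRight (v : TorusSite d' N) (a b : FermionTorus d' N) :
    (homTorusGraph φ).Adj (FermionTorus.ofTorusEquiv (Equiv.addRight v) a)
        (FermionTorus.ofTorusEquiv (Equiv.addRight v) b) ↔ (homTorusGraph φ).Adj a b := by
  rw [homTorusGraph_adj, homTorusGraph_adj, FermionTorus.toTorusSite_ofTorusEquiv,
    FermionTorus.toTorusSite_ofTorusEquiv, Equiv.coe_addRight]
  exact homSiteGraph_adj_add_right φ v _ _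

/-- **The Hubbard Hamiltonian of the torus generated by `φ`**: the tree's graph Hamiltonian
`hamiltonian (homTorusGraph φ) t U = −t Σ_{a∼b,σ} c†_{aσ} c_{bσ} + U Σ_a n_{a↑} n_{a↓}` on
`Fock (Orb (FermionTorus d' N))`. For the CRT map of an `a × b` torus (`gcd(a,b)=1`) it is unitarily
the nearest-neighbour Hubbard Hamiltonian of the periodic `a × b` torus. [cite: arXiv9311033, §2] -/
def homHubbard (t U : ℝ) : Matrix (Finset (Orb (FermionTorus d' N))) (Finset (Orb (FermionTorus d' N))) ℂ :=
  hamiltonian (homTorusGraph φ) t U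

omit [NeZero N] in
/-- `homHubbard φ t U` is Hermitian. [cite: arXiv9311033, §2] -/
theorem homHubbard_isHermitian (t U : ℝ) : (homHubbard φ t U).IsHermitian :=
  (hamiltonian_isHermitian_and_commute_holds (homTorusGraph φ) t U).1

omit [NeZero N] in
/-- `homHubbard φ t U` commutes with the particle number. [cite: arXiv9311033, §2] -/
theorem homHubbard_commute_totalNumber (t U : ℝ) :
    Commute (homHubbard φ t U) (totalNumber : Matrix (Finset (Orb (FermionTorus d' N))) _ ℂ) :=
  (hamiltonian_isHermitian_and_commute_holds (homTorusGraph φ) t U).2.1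

omit [NeZero N] in
/-- `homHubbard φ t U` commutes with `S^z`. [cite: arXiv9311033, §2] -/
theorem homHubbard_commute_spinZ (t U : ℝ) :
    Commute (homHubbard φ t U) (HubbardWave0.spinZ : Matrix (Finset (Orb (FermionTorus d' N))) _ ℂ) :=
  (hamiltonian_isHermitian_and_commute_holds (homTorusGraph φ) t U).2.2

omit [NeZero N] in
/-- `homHubbard φ t U` preserves the joint `(N, S^z)` sectors. [cite: LiebPRL1989] -/
theorem mulVec_homHubbard_mem_szSector (t U : ℝ) {n : ℕ} {M : ℝ}
    {ψ : Fock (Orb (FermionTorus d' N))} (hψ : ψ ∈ szSector n M) : homHubbard φ t U *ᵥ ψ ∈ szSector n M :=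
  mulVec_mem_szSector_of_commute (homHubbard_commute_totalNumber φ t U) (homHubbard_commute_spinZ φ t U) hψ

/-- **Translation invariance**: `T_v (homHubbard φ t U) T_v⁻¹ = homHubbard φ t U` for every
translation `v` of `(ℤ/Nℤ)^{d'}`. [cite: BenfattoGiulianiMastropietro2006, §2.2] -/
theorem relabel_translate_homHubbard (v : TorusSite d' N) (t U : ℝ) :
    relabel (Orb.translate v) (homHubbard φ t U) = homHubbard φ t U :=
  relabel_hamiltonian _ _ _ (homTorusGraph_adj_addRight φ v) t U

/-- `U_v H = H U_v` for the translation unitaries `U_v = fockTranslate v`. [folklore] -/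
theorem fockTranslate_mul_homHubbard (v : TorusSite d' N) (t U : ℝ) :
    (fockTranslate v).val * homHubbard φ t U = homHubbard φ t U * (fockTranslate v).val :=
  (fockRelabel_commute_of_relabel_eq _ (relabel_translate_homHubbard φ v t U)).eq

/-! ### §2. Non-degenerate hops and neighbour sums -/

omit [NeZero N] in
/-- The `2d` signed hops `(i, true) ↦ φ(eᵢ)`, `(i, false) ↦ −φ(eᵢ)`. [folklore] -/
def signedHop (p : Fin d × Bool) : TorusSite d' N := bif p.2 then φ (unitVec p.1) else -φ (unitVec p.1)

omit [NeZero N] in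
/-- **Non-degenerate hops** — the `2d` signed hops `±φ(eᵢ)` pairwise distinct,
`Function.Injective (signedHop φ)` (so every site has exactly `2d` neighbours and no hop is its own
inverse; for `φ = (x ↦ x mod L)` this is `L ≥ 3`, for the CRT ring of the `3 × 4` torus it is
`{4, 8, 9, 3}` distinct mod `12`) — then no hop vanishes. [folklore] -/
theorem signedHop_ne_zero (h : Function.Injective (signedHop φ)) (p : Fin d × Bool) : signedHop φ p ≠ 0 := by
  intro hp
  have h0 : φ (unitVec p.1) = 0 := by
    obtain ⟨i, b⟩ := p
    cases b
    · simpa [signedHop] using hp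
    · simpa [signedHop] using hp
  have h1 : signedHop φ (p.1, true) = signedHop φ (p.1, false) := by simp [signedHop, h0]
  simpa using h (a₁ := (p.1, true)) (a₂ := (p.1, false)) h1

/-- Under non-degenerate hops, the neighbours of `x` are exactly the `2d` sites `x + (±φ(eᵢ))`. [folklore] -/
theorem filter_homSiteGraph_adj_eq_image (h : Function.Injective (signedHop φ)) (x : TorusSite d' N) :
    (Finset.univ.filter fun y => (homSiteGraph φ).Adj x y) =
      Finset.univ.image fun p : Fin d × Bool => x + signedHop φ p := by
  ext y
  simp only [Finset.mem_filter, Finset.mem_univ, true_and, Finset.mem_image, homSiteGraph_adj_iff]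
  constructor
  · rintro ⟨-, i, hy | hx⟩
    · exact ⟨(i, true), by simp [signedHop, hy]⟩
    · exact ⟨(i, false), by rw [hx]; simp [signedHop]⟩
  · rintro ⟨⟨i, b⟩, rfl⟩
    refine ⟨fun hx => signedHop_ne_zero φ h (i, b) (add_left_cancel ((add_zero x).trans hx)).symm, i, ?_⟩
    cases b
    · exact Or.inr (by simp [signedHop])
    · exact Or.inl (by simp [signedHop])

/-- **Neighbour sums on the torus generated by `φ`** (non-degenerate hops):
`Σ_{y ∼ x} g(y) = Σᵢ (g(x + φ eᵢ) + g(x − φ eᵢ))` (the tree's `sum_ite_torusGraph_adj_matrix` for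
`x ↦ x mod L`, `L ≥ 3`). [cite: FriedliVelenik2017, §3.1] -/
theorem sum_ite_homSiteGraph_adj {M : Type*} [AddCommMonoid M] (h : Function.Injective (signedHop φ)) (x : TorusSite d' N)
    (g : TorusSite d' N → M) :
    (∑ y, if (homSiteGraph φ).Adj x y then g y else 0) =
      ∑ i : Fin d, (g (x + φ (unitVec i)) + g (x - φ (unitVec i))) := by
  rw [← Finset.sum_filter, filter_homSiteGraph_adj_eq_image φ h x,
    Finset.sum_image fun p _ q _ hpq => h (add_left_cancel hpq), Fintype.sum_prod_type]
  refine Finset.sum_congr rfl fun i _ => ?_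
  rw [Fintype.sum_bool]
  simp [signedHop, sub_eq_add_neg]

/-! ### §3. The window embedding `x ↦ φ x` -/

/-- `x ↦ ofTorusSite (φ x)` is injective where `φ` is. [folklore] -/
theorem injOn_ofTorusSite_hom {S : Finset (Site d)} (h : Set.InjOn φ ↑S) :
    Set.InjOn (fun x : Site d => FermionTorus.ofTorusSite (φ x)) ↑S := fun x hx y hy hxy =>
  h hx hy (by simpa using congrArg FermionTorus.toTorusSite hxy)

/-- **The site map of a region `Λ ⊆ ℤ^d` into the torus generated by `φ`**, `x ↦ φ x`, an injection
of ordered site sets when `φ` is injective on `Λ` ("pull `Λ` back into the torus"; the tree's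
`PolySite.toTorusEmb` is `φ = (x ↦ x mod L)`). [cite: FriedliVelenik2017, §3.1] -/
def homEmb {Λ : Finset (Site d)} (h : Set.InjOn φ ↑Λ) : PolySite Λ ↪ FermionTorus d' N :=
  ⟨fun y => FermionTorus.ofTorusSite (φ (ofLex y.1)), fun y y' hyy => by
    have h1 : φ (ofLex y.1) = φ (ofLex y'.1) := by
      simpa using congrArg FermionTorus.toTorusSite hyy
    exact Subtype.ext (congrArg toLex (h (PolySite.ofLex_mem y) (PolySite.ofLex_mem y') h1))⟩

/-- `homEmb` on an ordered site. [folklore] -/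
@[simp] theorem homEmb_apply {Λ : Finset (Site d)} (h : Set.InjOn φ ↑Λ) (y : PolySite Λ) :
    homEmb φ h y = FermionTorus.ofTorusSite (φ (ofLex y.1)) := rfl

/-- The torus site of `x ∈ Λ` under `homEmb` is `φ x`. [folklore] -/
theorem homEmb_pt {Λ : Finset (Site d)} (h : Set.InjOn φ ↑Λ) (x : Site d) (hx : x ∈ Λ) :
    homEmb φ h (PolySite.pt x hx) = FermionTorus.ofTorusSite (φ x) := rfl

/-! ### §4. Lattice bonds versus torus bonds (sharp hypothesis: `φ` injective on the window) -/

/-- **Lattice neighbours in the window are torus neighbours**: for `x ∼ y` in `ℤ^d` with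
`x, y ∈ Λ'` and `φ` injective on `Λ'`, `φ x ∼ φ y`. [cite: FriedliVelenik2017, §3.1] -/
theorem homTorusGraph_adj_of_zdAdj {Λ' : Finset (Site d)} (hInj : Set.InjOn φ ↑Λ') {x y : Site d}
    (hx : x ∈ Λ') (hy : y ∈ Λ') (hxy : (zdGraph d).Adj x y) :
    (homTorusGraph φ).Adj (FermionTorus.ofTorusSite (φ x)) (FermionTorus.ofTorusSite (φ y)) := by
  rw [homTorusGraph_adj_ofTorusSite, homSiteGraph_adj_iff]
  refine ⟨fun h => hxy.ne (hInj hx hy h), ?_⟩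
  rw [zdGraph_adj_iff] at hxy
  obtain ⟨i, hi | hi⟩ := hxy
  · exact ⟨i, Or.inl (by rw [hi, map_add])⟩
  · exact ⟨i, Or.inr (by rw [hi, map_add])⟩

/-- **A torus bond at the image of the inner region comes from a lattice bond**: if `x ∈ Λ`, all
lattice neighbours of `x` lie in `Λ'`, `y ∈ Λ'`, `φ` is injective on `Λ'` and `φ x ∼ φ y`, then
`x ∼ y` in `ℤ^d`. [cite: FriedliVelenik2017, §3.1] -/
theorem zdAdj_of_homTorusGraph_adj {Λ Λ' : Finset (Site d)}
    (hclosed : ∀ x ∈ Λ, ∀ i : Fin d, x + unitVec i ∈ Λ' ∧ x - unitVec i ∈ Λ')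
    (hInj : Set.InjOn φ ↑Λ') {x y : Site d} (hx : x ∈ Λ) (hy : y ∈ Λ')
    (hadj : (homTorusGraph φ).Adj (FermionTorus.ofTorusSite (φ x)) (FermionTorus.ofTorusSite (φ y))) :
    (zdGraph d).Adj x y := by
  rw [homTorusGraph_adj_ofTorusSite, homSiteGraph_adj_iff] at hadj
  rw [zdGraph_adj_iff]
  obtain ⟨-, i, hi | hi⟩ := hadj
  · refine ⟨i, Or.inl (hInj hy (hclosed x hx i).1 ?_)⟩
    rw [hi, map_add]
  · have hy' : y = x - unitVec i :=
      hInj hy (hclosed x hx i).2 (by rw [map_sub, hi, add_sub_cancel_right])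
    exact ⟨i, Or.inr (by rw [hy']; exact (sub_add_cancel x _).symm)⟩

/-- A site of `Λ'` whose image lies in the image of `Λ ⊆ Λ'` is a site of `Λ`. [folklore] -/
theorem mem_of_hom_mem_image {Λ Λ' : Finset (Site d)} (hΛ : Λ ⊆ Λ') (hInj : Set.InjOn φ ↑Λ')
    {x : Site d} (hx : x ∈ Λ')
    (hmem : FermionTorus.ofTorusSite (φ x) ∈ Λ.image fun z => FermionTorus.ofTorusSite (φ z)) : x ∈ Λ := by
  obtain ⟨z, hz, hzx⟩ := Finset.mem_image.1 hmem
  have hzx' : z = x := hInj (hΛ hz) hx (by simpa using congrArg FermionTorus.toTorusSite hzx)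
  rw [hzx'] at hz
  exact hz

/-- **A torus bond touching the image of `Λ` lies inside the image of `Λ'`** when every lattice
neighbour of `Λ` is in `Λ'`. [cite: FriedliVelenik2017, §3.1] -/
theorem mem_image_of_homTorusGraph_adj {Λ Λ' : Finset (Site d)}
    (hclosed : ∀ x ∈ Λ, ∀ i : Fin d, x + unitVec i ∈ Λ' ∧ x - unitVec i ∈ Λ') {x : Site d} (hx : x ∈ Λ)
    {b : FermionTorus d' N} (hab : (homTorusGraph φ).Adj (FermionTorus.ofTorusSite (φ x)) b) :
    b ∈ Λ'.image fun y => FermionTorus.ofTorusSite (φ y) := by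
  rw [homTorusGraph_adj, FermionTorus.toTorusSite_ofTorusSite, homSiteGraph_adj_iff] at hab
  obtain ⟨-, i, hi | hi⟩ := hab
  · refine Finset.mem_image.2 ⟨x + unitVec i, (hclosed x hx i).1, ?_⟩
    rw [map_add, ← hi, FermionTorus.ofTorusSite_toTorusSite]
  · refine Finset.mem_image.2 ⟨x - unitVec i, (hclosed x hx i).2, ?_⟩
    rw [map_sub, hi, add_sub_cancel_right, FermionTorus.ofTorusSite_toTorusSite]

/-- If a torus bond `c ∼ c'` starts in the image of `Λ`, both ends lie in the image of `Λ' ⊇ Λ`.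
[cite: FriedliVelenik2017, §3.1] -/
theorem mem_image_and_mem_image_of_homTorusGraph_adj {Λ Λ' : Finset (Site d)} (hΛ : Λ ⊆ Λ')
    (hclosed : ∀ x ∈ Λ, ∀ i : Fin d, x + unitVec i ∈ Λ' ∧ x - unitVec i ∈ Λ')
    {c c' : FermionTorus d' N} (hcc' : (homTorusGraph φ).Adj c c')
    (hc : c ∈ Λ.image fun x => FermionTorus.ofTorusSite (φ x)) :
    c ∈ Λ'.image (fun x => FermionTorus.ofTorusSite (φ x)) ∧
      c' ∈ Λ'.image (fun x => FermionTorus.ofTorusSite (φ x)) := by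
  obtain ⟨x, hx, rfl⟩ := Finset.mem_image.1 hc
  exact ⟨Finset.mem_image.2 ⟨x, hΛ hx, rfl⟩, mem_image_of_homTorusGraph_adj φ hclosed hx hcc'⟩

end Model

end Summit.Ventures.CertifiedManyBodySolver.Rows

end
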